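import Summits.BirchSwinnertonDyer.Rank1Residual.WAll.TargetCMTwoRamifiedThetaFour
import Literature.NumberTheory.EllipticCurves.TianYuanZhang2017.GenusPointDescentDisplays
import HarnessLib
import HarnessLib.Audit.Tags

/-!
# Rung W-ALL of ladder BSD (D-0120) — the ramified slice of row 12₂: THE UNIFORM Θ-CRITERION CLASS OF CELL `bsd-monsky`
# (route B's operator `θ`, «Tian's induction on the number of prime factors», ALL square-free `n ≡ 6 (mod 8)` at once)
# CARVED OUT OF THE RESIDUAL OF CRUX stmt-BirchSwinnertonDyer-20509, BY NAME — membership = an explicit, per-`n` DECIDABLE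
# Θ-certificate (cell `bsd-print-cf2`, D-0131 (2) PRINT TIER, seat p1 = lead of crux `RamifiedOffTYZOfFacts`)

HONEST FRAMING (cell `bsd-print-cf2`, run/shared/lean/pub/bsd-print-cf2/; partition leaf «CornerF @ `p = 2`» =
`Summit.BirchSwinnertonDyer.WAllCornerFTwo`, OPEN AS A CLASS): STATEMENTS AND BOOKKEEPING ONLY — nothing asserted,
nothing booked, no named fact introduced, no published theorem restated. The theta-descent leaves booked so far
(`WAllCornerFTwoRamifiedTheta`, aside 21185: towers/stars and the five `k = 3` shapes; `WAllCornerFTwoRamifiedThetaFour`: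
the `(3,5,5,5)` shape) are the EXPLICIT SHAPES on which cell `bsd-monsky`'s prover-B evaluated route B's operator `θ` in
closed form. The tree also holds the UNIFORM form (`P2/CongruentNumberThetaCriterion.lean`,
`P2.ThetaDescent.exists_odd_isScriptL_of_thetaCert_of_cmPointGaloisData`): for EVERY square-free `n ≡ 6 (mod 8)` that is
`θ`-CONTROLLED (closed form: every `7`-block `d₀ ∣ n` with `n/d₀ ≡ 2 (mod 8)` has only good `5`-divisors) and admits a
Θ-CERTIFICATE `s` on the `6`-blocks `e ∣ n` with `n/e ≡ 1 (mod 8)` — `s(e) = g(e) + Σ_{d₀ ∈ R(e), d₀ ≡ 6} 𝓛(e/d₀)·s(d₀)`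
— with `Θ(n) = s(n)` odd, the invariant `𝓛(n)` is ODD (relative to `tyz_cmPointGaloisData` + GZK). The cofactors
`e/d₀` are `≡ 1 (mod 8)`, where TYZ Thm 1.1 (`thm11_parity_of_scriptL`) reads `𝓛(e/d₀) ≡ Σ₁(e/d₀) (mod 2)` — so the
certificate is a DECIDABLE arithmetic condition on `n` (genus class numbers `g(d) = #2Cl(ℚ(√−d))` of divisors only),
and with Monsky's `s(n) = 1` the GZK-only uniform even door (`P2.rankOne_sha_bsdp_two_iff_congruentNumberCurve_two_mul_prod_descent`)
turns `𝓛(n)` odd into `ord_{s=1} L = 1 ∧ rank 1 ∧ Ш[2^∞] = 0 ∧ BSD(E_n, 2)`. This file NAMES that class — membership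
VERBATIM the hypotheses of the uniform criterion with `𝓛(e/d₀)` replaced by `Σ₁(e/d₀)` — and carves it out of the
residual of crux 20509 in isogeny-class currency:

* §1 `CongruentThetaCriterionFamily` (prime vector `p`, `n = 2∏pᵢ ≡ 6 (mod 8)`, `monskySelmerRankEven p = 1`,
  `θ`-control, ∃ Θ-certificate with `s(n) = 1`, `∃ C, C • E_n = W`) and its isogeny closure
  `CongruentThetaCriterionIsogenyClass`;
* §2 the leaf `WAllCornerFTwoRamifiedThetaCriterion` and the residual `WAllCornerFTwoRamifiedOffBookedIsogenyOffThetaCriterion`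
  (off the booked isogeny classes, the Shu–Zhai classes, the four-prime classes AND the Θ-criterion classes);
* §3 membership facts (square-free even parameter ⇒ CM by `ℤ[i]`, `2` ramified; disjoint from the proved TYZ families);
* §4 glue, EXACT: `WAllCornerFTwoRamifiedOffBookedIsogenyOffThetaFour` ⟺ (its Θ-criterion part) ∧ the new residual; the
  five-leaf composition for the lead's skeleton v5; the cut of the ramified slice; restrictions from row 12₂.
Census (this seat, evidence CENSUS-p1-g3-20509.md on the crux; n ≤ 3·10⁴, even, `s(n) = 1`): the criterion holds on ALL
1373 booked theta / tower / `𝒮⁻` / four-prime members and on 240 further classes (237 inside the U⁺ leaf, 3 in no booked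
leaf: `6630, 16422, 18870`); it is silent on 85 + uncontrolled on 61 of the 149 printless `s = 1` genus-even classes. The
closer lands in `Summits/BirchSwinnertonDyer/BirchSwinnertonDyer/Theorems/PrintCf2RamifiedOffTYZThetaCriterionLeaf.lean`
(seat p1): LITERAL-by-name(hCM), from EXACTLY the antecedent of aside 21185 (TURNKEY there).

WHY (seat p1, strategy «Tian–Yuan–Zhang induction BY NAME … typed as class theorems on explicit infinite families»):
this is the class theorem OF the induction itself (route-B form), uniform in the number of prime factors, on an explicit
decidable family; beyond print (Monsky 1990 p. 67 Rem. (3) = `k = 2`; TYZ Thm 1.2 silent on part of the class).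

References: `P2/CongruentNumberThetaCriterion{,Cosets,Package}.lean` (cell `bsd-monsky`, prover-B),
`WAll/TargetCMTwoRamifiedThetaFour.lean`, `WAll/TargetCMTwoRamifiedBookedIsogeny.lean` (this seat),
`Literature/…/TianYuanZhang2017/GenusPointDescentDisplays.lean` (`recursionIndex`), `…/GenusPeriodsParity.lean`
(`genusSum₁`, `genusClassNumber`). [cite: TianYuanZhang2017, Thm. 1.1, §3.1 (J738–J739), Prop. 3.2, Thm. 3.5, Thm. 3.6,
Lemma 3.18, proof of Lemma 3.21 (J759)] [cite: Monsky1990MockHeegner, p. 67 Remark (3)] [cite: HeathBrown1994SelmerCongruentII,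
Appendix (Monsky), typescript p. 41 L20–L36] [cite: Miller2011LMS, §1 and Def. 1.1] [cite: MilneADT2006, Thm. I.7.3].
-/

noncomputable section

open scoped Classical

open WeierstrassCurve Literature.NumberTheory.EllipticCurves
  Literature.NumberTheory.EllipticCurves.Rank1Residual
  Literature.NumberTheory.EllipticCurves.HeathBrown1994
  Literature.NumberTheory.EllipticCurves.TianYuanZhang2017
open Summit.BirchSwinnertonDyer.Rank1Residual

set_option autoImplicit false

namespace Summit.BirchSwinnertonDyer

/-! ### §1. Membership predicates: the uniform Θ-criterion class and its `ℚ`-isogeny closure -/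

/-- **The uniform Θ-criterion class of cell `bsd-monsky` (route B, all `k`)** as a class at `2`: `W` is a `ℚ`-model of
`E_n`, `n = 2p₁⋯p_k ≡ 6 (mod 8)` (distinct primes), with Monsky's `s(n) = 1`, `n` `θ`-CONTROLLED (every `7`-block
`d₀ ∣ n` with `n/d₀ ≡ 2 (mod 8)` has only `5`-divisors all of whose primes are `≡ 1 (mod 4)`), and a Θ-CERTIFICATE
`s : ℕ → ℤ/2` on the `6`-blocks `e ∣ n` with `n/e ≡ 1 (mod 8)`,
`s(e) = g(e) + Σ_{d₀ ∈ R(e), d₀ ≡ 6 (8)} Σ₁(e/d₀)·s(d₀)`, `s(n) = 1` — VERBATIM the hypotheses `hctrl`, `hΘ` of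
`P2.ThetaDescent.exists_odd_isScriptL_of_thetaCert_of_cmPointGaloisData` with the data-dependent parity `𝓛(e/d₀)` replaced by
TYZ Thm 1.1's `Σ₁(e/d₀)` (`e/d₀ ≡ 1 (mod 8)`), `g(d) = #2Cl(ℚ(√−d))` read in `GenusField d`. Decidable per `n`
(Rédei matrices); nothing asserted. [cite: TianYuanZhang2017, Thm. 1.1, §3.1, Thm. 3.5, Thm. 3.6]
[cite: HeathBrown1994SelmerCongruentII, Appendix (Monsky), typescript p. 41 L36] -/
def CongruentThetaCriterionFamily : P2.ClassAtTwo := fun W _ _ =>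
  ∃ (k : ℕ) (p : Fin k → ℕ) (n : ℕ), (∀ i, (p i).Prime) ∧ Function.Injective p ∧ 2 * ∏ i, p i = n ∧ n % 8 = 6 ∧
    monskySelmerRankEven p = 1 ∧
    (∀ d₀ ∈ n.divisors, d₀ % 8 = 7 → (n / d₀) % 8 = 2 → ∀ d' ∈ d₀.divisors, d' % 8 = 5 →
      ∀ q ∈ d'.primeFactors, q % 4 = 1) ∧
    (∃ s : ℕ → ZMod 2,
      (∀ e ∈ n.divisors, e % 8 = 6 → (n / e) % 8 = 1 →
        s e = (genusClassNumber (GenusField e) : ZMod 2) +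
          ∑ d₀ ∈ (recursionIndex e).filter (fun d₀ => d₀ % 8 = 6),
            (genusSum₁ (e / d₀) (fun d => genusClassNumber (GenusField d)) : ZMod 2) * s d₀) ∧
      s n = 1) ∧
    ∃ C : VariableChange ℚ, C • congruentNumberCurve n = W

/-- **`W` lies in the `ℚ`-isogeny class of a member of the Θ-criterion class.** A definition with a body (data `W₀`),
not a named fact; nothing asserted. [cite: CremonaAlgorithms1997, §3.8 and Table 1 (class 32a)] -/
def CongruentThetaCriterionIsogenyClass (W : WeierstrassCurve ℚ) : Prop :=
  ∃ (W₀ : WeierstrassCurve ℚ) (_ : W₀.IsElliptic) (_ : W₀.IsGloballyMinimal),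
    IsIsogenous W W₀ ∧ CongruentThetaCriterionFamily W₀

/-! ### §2. Leaves: the Θ-criterion slice (isogeny classes) and the residual off it -/

/-- **Ramified slice ON THE ISOGENY CLASSES OF THE UNIFORM Θ-CRITERION CLASS** (closed BEYOND `𝔅_ram` by
`PrintCf2.wAllCornerFTwoRamifiedThetaCriterion_of_facts (hCM) (h11) (hGZK) (hCAS) (hMOD)`): CM, `ord_{s=1} L(E,s) = 1`,
`2 ∣ d_K`, `W` isogenous to a member ⇒ `BSD(E,2)`. [folklore] -/
@[conjecture] def WAllCornerFTwoRamifiedThetaCriterion : Prop :=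
  ∀ (W : WeierstrassCurve ℚ) [W.IsElliptic] [W.IsGloballyMinimal],
    W.HasCM → W.analyticRank = 1 → CMRamified W 2 → CongruentThetaCriterionIsogenyClass W → BSDp W 2

/-- **THE RESIDUAL OF CRUX 20509 IN ISOGENY-CLASS CURRENCY, OFF THE Θ-CRITERION CLASS TOO (OPEN)**: CM,
`ord_{s=1} L(E,s) = 1`, `2 ∣ d_K`, and `W` is `ℚ`-isogenous to NO member of the five booked congruent-number families,
NO Shu–Zhai twist of `256c1`, NO four-prime theta member and NO member of the Θ-criterion class ⇒ `BSD(E,2)`. Contains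
(census n ≤ 3·10⁴): the `E_m` classes with `s(m) ≥ 3` (odd 596, even 288), odd `s = 1` genus-even (73), even `s = 1`
genus-even Θ-silent (85) or `θ`-uncontrolled (61); the quartic classes `y² = x³ + Ax` without any `E_m` off the
Shu–Zhai classes (kit j287735: 1326 of analytic rank one with `|A| ≤ 1500`); all of `j = 8000`. No theorem in print.
[folklore] -/
@[conjecture] def WAllCornerFTwoRamifiedOffBookedIsogenyOffThetaCriterion : Prop :=
  ∀ (W : WeierstrassCurve ℚ) [W.IsElliptic] [W.IsGloballyMinimal],
    W.HasCM → W.analyticRank = 1 → CMRamified W 2 →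
      ¬ CongruentBookedIsogenyClass W → ¬ P2.IsIsogenousToShuZhaiTwoFiftySixTwist W →
      ¬ CongruentThetaFourIsogenyClass W → ¬ CongruentThetaCriterionIsogenyClass W → BSDp W 2

/-! ### §3. Membership facts -/

/-- The primes of `n = 2p₁⋯p_k ≡ 6 (mod 8)` are odd (a factor `2` would give `4 ∣ n`). [folklore] -/
theorem odd_of_two_mul_prod_eq_of_mod_eight {k : ℕ} {p : Fin k → ℕ} {n : ℕ} (hp : ∀ i, (p i).Prime)
    (hn : 2 * ∏ i, p i = n) (h6 : n % 8 = 6) (i : Fin k) : Odd (p i) := by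
  rcases (hp i).eq_two_or_odd' with h2 | hodd
  · exfalso
    obtain ⟨c, hc⟩ : p i ∣ ∏ j, p j := Finset.dvd_prod_of_mem p (Finset.mem_univ i)
    rw [h2] at hc
    omega
  · exact hodd

/-- **Every member of `CongruentThetaCriterionFamily` is a `ℚ`-model of `E_n` with `n` square-free and EVEN.** [folklore] -/
theorem exists_smul_congruentNumberCurve_even_of_congruentThetaCriterionFamily {W : WeierstrassCurve ℚ} [W.IsElliptic]
    [W.IsGloballyMinimal] (h : CongruentThetaCriterionFamily W) :
    ∃ n : ℕ, Squarefree n ∧ n % 2 = 0 ∧ ∃ C : VariableChange ℚ, C • congruentNumberCurve n = W := by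
  obtain ⟨k, p, n, hp, hinj, hn, h6, -, -, -, C, hC⟩ := h
  have hodd : ∀ i, Odd (p i) := odd_of_two_mul_prod_eq_of_mod_eight hp hn h6
  exact ⟨n, hn ▸ squarefree_two_mul_prod_of_injective p hp hodd hinj, by omega, C, hC⟩

/-- Every member of `CongruentThetaCriterionFamily` has CM by `ℤ[i]` with `2` ramified (`j = 1728`). [folklore] -/
theorem hasCM_and_cmRamified_two_of_congruentThetaCriterionFamily {W : WeierstrassCurve ℚ} [W.IsElliptic]
    [W.IsGloballyMinimal] (h : CongruentThetaCriterionFamily W) : W.HasCM ∧ CMRamified W 2 := by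
  obtain ⟨n, hsq, -, C, hC⟩ := exists_smul_congruentNumberCurve_even_of_congruentThetaCriterionFamily h
  exact hasCM_and_cmRamified_two_of_smul_congruentNumberCurve hsq.ne_zero hC

/-- A model member of the Θ-criterion class is an isogeny member (`W₀ := W`). [folklore] -/
theorem congruentThetaCriterionIsogenyClass_of_congruentThetaCriterionFamily {W : WeierstrassCurve ℚ} [W.IsElliptic]
    [W.IsGloballyMinimal] (h : CongruentThetaCriterionFamily W) : CongruentThetaCriterionIsogenyClass W :=
  ⟨W, ‹_›, ‹_›, isIsogenous_self W, h⟩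

/-- **The isogeny classes of the Θ-criterion class lie in the ramified slice** (CM and the CM type are `ℚ`-isogeny
invariants). [cite: SilvermanAdvancedTopics1994, Exercise 2.12(b) and App. A §3 (p. 483)] -/
theorem hasCM_and_cmRamified_two_of_congruentThetaCriterionIsogenyClass {W : WeierstrassCurve ℚ} [W.IsElliptic]
    (h : CongruentThetaCriterionIsogenyClass W) : W.HasCM ∧ CMRamified W 2 := by
  obtain ⟨W₀, _, _, hiso, hF⟩ := h
  obtain ⟨hCM₀, hram₀⟩ := hasCM_and_cmRamified_two_of_congruentThetaCriterionFamily hF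
  have hCM : W.HasCM := (X12.hasCM_iff_of_isIsogenous hiso).mpr hCM₀
  exact ⟨hCM, (X12.cmRamified_iff_of_isIsogenous hiso hCM 2).mpr hram₀⟩

/-- **The Θ-criterion class is disjoint from the proved TYZ families** (even vs. odd square-free parameter). [folklore] -/
theorem not_congruentTYZProvedFamily_of_congruentThetaCriterionFamily {W : WeierstrassCurve ℚ} [W.IsElliptic]
    [W.IsGloballyMinimal] (h : CongruentThetaCriterionFamily W) : ¬ CongruentTYZProvedFamily W := by
  intro hP
  obtain ⟨n, hsq, hn2, C, hC⟩ := exists_smul_congruentNumberCurve_even_of_congruentThetaCriterionFamily h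
  obtain ⟨m', hm', hm2, C', hC'⟩ := exists_smul_congruentNumberCurve_odd_of_congruentTYZProvedFamily hP
  have h := P2.CornerFTwo.Atlas.eq_of_smul_congruentNumberCurve hsq hm' hC hC'
  omega

/-! ### §4. Glue (excluded middle on membership only; every cut exact) -/

/-- **The residual off the four-prime family ⟺ (its Θ-criterion part) ∧ the residual off the Θ-criterion class**
(EXACT; pure logic). [folklore] -/
theorem wAllCornerFTwoRamifiedOffBookedIsogenyOffThetaFour_iff_onThetaCriterion_off :
    WAllCornerFTwoRamifiedOffBookedIsogenyOffThetaFour ↔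
      (∀ (W : WeierstrassCurve ℚ) [W.IsElliptic] [W.IsGloballyMinimal],
          W.HasCM → W.analyticRank = 1 → CMRamified W 2 → ¬ CongruentBookedIsogenyClass W →
            ¬ P2.IsIsogenousToShuZhaiTwoFiftySixTwist W → ¬ CongruentThetaFourIsogenyClass W →
            CongruentThetaCriterionIsogenyClass W → BSDp W 2) ∧
      WAllCornerFTwoRamifiedOffBookedIsogenyOffThetaCriterion := by
  constructor
  · intro h
    exact ⟨fun W _ _ hcm hr1 hram h1 h2 h3 _ ↦ h W hcm hr1 hram h1 h2 h3,
      fun W _ _ hcm hr1 hram h1 h2 h3 _ ↦ h W hcm hr1 hram h1 h2 h3⟩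
  · rintro ⟨hT, hO⟩ W _ _ hcm hr1 hram h1 h2 h3
    by_cases h4 : CongruentThetaCriterionIsogenyClass W
    · exact hT W hcm hr1 hram h1 h2 h3 h4
    · exact hO W hcm hr1 hram h1 h2 h3 h4

/-- **The residual off the four-prime family from the Θ-criterion leaf and the residual off it** (the reduction used by
the lead's skeleton of crux 20509). [folklore] -/
theorem wAllCornerFTwoRamifiedOffBookedIsogenyOffThetaFour_of_thetaCriterion_of_off
    (hT : WAllCornerFTwoRamifiedThetaCriterion) (hO : WAllCornerFTwoRamifiedOffBookedIsogenyOffThetaCriterion) :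
    WAllCornerFTwoRamifiedOffBookedIsogenyOffThetaFour :=
  wAllCornerFTwoRamifiedOffBookedIsogenyOffThetaFour_iff_onThetaCriterion_off.2
    ⟨fun W _ _ hcm hr1 hram _ _ _ h4 ↦ hT W hcm hr1 hram h4, hO⟩

/-- The residual off the Θ-criterion class is a restriction of the residual off the four-prime family. [folklore] -/
theorem wAllCornerFTwoRamifiedOffBookedIsogenyOffThetaCriterion_of_offThetaFour
    (h : WAllCornerFTwoRamifiedOffBookedIsogenyOffThetaFour) :
    WAllCornerFTwoRamifiedOffBookedIsogenyOffThetaCriterion :=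
  (wAllCornerFTwoRamifiedOffBookedIsogenyOffThetaFour_iff_onThetaCriterion_off.1 h).2

/-- **Crux 20509's conclusion from FIVE leaves** — booked-isogeny, Shu–Zhai `256c1`, four-prime theta, Θ-criterion, and
the residual off all of them (excluded middle only). [folklore] -/
theorem wAllCornerFTwoRamifiedOffTYZProved_of_bookedIsogeny_of_shuZhai_of_thetaFour_of_thetaCriterion_of_off
    (hI : WAllCornerFTwoRamifiedBookedIsogeny) (hZ : WAllCornerFTwoRamifiedShuZhaiTwoFiftySix)
    (hT4 : WAllCornerFTwoRamifiedThetaFour) (hT : WAllCornerFTwoRamifiedThetaCriterion)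
    (hO : WAllCornerFTwoRamifiedOffBookedIsogenyOffThetaCriterion) : WAllCornerFTwoRamifiedOffTYZProved :=
  wAllCornerFTwoRamifiedOffTYZProved_of_bookedIsogeny_of_shuZhai_of_thetaFour_of_off hI hZ hT4
    (wAllCornerFTwoRamifiedOffBookedIsogenyOffThetaFour_of_thetaCriterion_of_off hT hO)

/-- **The ramified slice of row 12₂ ⟺ booked-isogeny ∧ Shu–Zhai `256c1` ∧ four-prime theta ∧ Θ-criterion ∧ the residual
off them** (EXACT). [folklore] -/
theorem wAllCornerFTwoRamified_iff_bookedIsogeny_shuZhai_thetaFour_thetaCriterion_off :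
    WAllCornerFTwoRamified ↔
      WAllCornerFTwoRamifiedBookedIsogeny ∧ WAllCornerFTwoRamifiedShuZhaiTwoFiftySix ∧
        WAllCornerFTwoRamifiedThetaFour ∧ WAllCornerFTwoRamifiedThetaCriterion ∧
        WAllCornerFTwoRamifiedOffBookedIsogenyOffThetaCriterion := by
  rw [wAllCornerFTwoRamified_iff_bookedIsogeny_shuZhai_thetaFour_off]
  constructor
  · rintro ⟨hI, hZ, hT4, hO⟩
    exact ⟨hI, hZ, hT4, fun W _ _ hcm hr1 hram _ ↦
        wAllCornerFTwoRamified_iff_bookedIsogeny_shuZhai_thetaFour_off.2 ⟨hI, hZ, hT4, hO⟩ W hcm hr1 hram,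
      wAllCornerFTwoRamifiedOffBookedIsogenyOffThetaCriterion_of_offThetaFour hO⟩
  · rintro ⟨hI, hZ, hT4, hT, hO⟩
    exact ⟨hI, hZ, hT4, wAllCornerFTwoRamifiedOffBookedIsogenyOffThetaFour_of_thetaCriterion_of_off hT hO⟩

/-- The Θ-criterion leaf is a restriction of the ramified slice … [folklore] -/
theorem wAllCornerFTwoRamifiedThetaCriterion_of_wAllCornerFTwoRamified (h : WAllCornerFTwoRamified) :
    WAllCornerFTwoRamifiedThetaCriterion :=
  fun W _ _ hcm hr1 hram _ ↦ h W hcm hr1 hram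

/-- … of row 12₂ … [folklore] -/
theorem wAllCornerFTwoRamifiedThetaCriterion_of_wAllCornerFTwo (h : WAllCornerFTwo) :
    WAllCornerFTwoRamifiedThetaCriterion :=
  wAllCornerFTwoRamifiedThetaCriterion_of_wAllCornerFTwoRamified (wAllCornerFTwo_iff_slices.1 h).2.2.1

/-- … and so is the residual off the Θ-criterion class. [folklore] -/
theorem wAllCornerFTwoRamifiedOffBookedIsogenyOffThetaCriterion_of_wAllCornerFTwoRamified (h : WAllCornerFTwoRamified) :
    WAllCornerFTwoRamifiedOffBookedIsogenyOffThetaCriterion :=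
  fun W _ _ hcm hr1 hram _ _ _ _ ↦ h W hcm hr1 hram

/-- **Row 12₂ with the ramified slice cut five ways in isogeny-class currency**: `WAllCornerFTwo` ⟺ split-good ∧ split-bad
∧ (booked-isogeny ∧ Shu–Zhai `256c1` ∧ four-prime theta ∧ Θ-criterion ∧ residual) ∧ inert-good ∧ inert-bad. [folklore] -/
theorem wAllCornerFTwo_iff_slices_bookedIsogeny_shuZhai_thetaFour_thetaCriterion_off :
    WAllCornerFTwo ↔ WAllCornerFTwoSplitGood ∧ WAllCornerFTwoSplitBad ∧
      (WAllCornerFTwoRamifiedBookedIsogeny ∧ WAllCornerFTwoRamifiedShuZhaiTwoFiftySix ∧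
        WAllCornerFTwoRamifiedThetaFour ∧ WAllCornerFTwoRamifiedThetaCriterion ∧
        WAllCornerFTwoRamifiedOffBookedIsogenyOffThetaCriterion) ∧
      WAllCornerFTwoInertGood ∧ WAllCornerFTwoInertBad := by
  rw [wAllCornerFTwo_iff_slices, wAllCornerFTwoRamified_iff_bookedIsogeny_shuZhai_thetaFour_thetaCriterion_off]

end Summit.BirchSwinnertonDyer

end
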